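import Mathlib
import HarnessLib
import Literature.Analysis.FluidPDE.ClassicalSolution
import Literature.Analysis.FluidPDE.ClassicalSolutionRescale
import Literature.Analysis.FluidPDE.WholeSpaceIBP
import Literature.Analysis.FunctionSpaces.SobolevDomain
import Literature.Analysis.FunctionSpaces.TorusTestFunction

/-!
# Stub `stub_shellDefectScaling` of the line `Sketch` (crux stmt-AnomalousDissipation-19035,
# `PointSink.SolitonTransplant`): the shell clause transports to every integer shell

Registered signature (proved here, textually; `E³ = EuclideanSpace ℝ (Fin 3)`, `𝕋³ = UnitAddTorus (Fin 3)`
are the skeleton's local notations, redeclared below):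
```
theorem stub_shellDefectScaling :
    ∀ (Q V : E³ → E³) (lam : ℝ), 1 < lam →
      (∀ x : E³, x ≠ 0 → V (lam • x) = lam ^ (-(2 / 3 : ℝ)) • V x) →
      Tendsto (fun k : ℕ => (lam ^ k) ^ (-(5 / 3 : ℝ)) *
        ∫ x in {x : E³ | lam ^ k < ‖x‖ ∧ ‖x‖ < lam ^ (k + 1)}, ‖Q x - V x‖ ^ 2) atTop (𝓝 0) →
      ∀ a : ℤ, Tendsto (fun k : ℕ =>
        ∫ x in {x : E³ | lam ^ a < ‖x‖ ∧ ‖x‖ < lam ^ (a + 1)},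
          ‖(lam ^ k) ^ (2 / 3 : ℝ) • Q (lam ^ k • x) - V x‖ ^ 2) atTop (𝓝 0)
```
For a discretely self-similar far field `V (λ x) = λ^{-2/3} V x` (`x ≠ 0`, `λ > 1`) and the
rescalings `Q_k x = (λ^k)^{2/3} Q (λ^k x)`, the shell clause
`(λ^k)^{-5/3} ∫_{λ^k<|x|<λ^{k+1}} |Q − V|² → 0` transports to every INTEGER shell index `a`:
`∫_{λ^a<|x|<λ^{a+1}} |Q_k − V|² → 0`.

Proof. (i) Iterating the self-similarity, `V (λ^k x) = (λ^k)^{-2/3} V x` off the origin, so on the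
shell (which misses the origin) `Q_k x − V x = (λ^k)^{2/3} (Q − V)(λ^k x)` and the integrand is
`(λ^k)^{4/3} |Q − V|²(λ^k x)`. (ii) The dilation `x ↦ λ^k x`
(`MeasureTheory.Measure.setIntegral_comp_smul_of_pos`, `finrank ℝ E³ = 3`, no integrability needed)
maps the shell `λ^a < |x| < λ^{a+1}` onto `λ^{a+k} < |y| < λ^{a+k+1}` with Jacobian `(λ^k)^{-3}`,
whence `∫_{shell a} |Q_k − V|² = (λ^k)^{-5/3} ∫_{shell (a+k)} |Q − V|²` for every `k`. (iii) Along
`k = m + k₀` with `0 ≤ a + k₀ =: n₀ ∈ ℕ` the index `a + k = m + n₀` is a natural number and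
`(λ^{m+k₀})^{-5/3} = C_a (λ^{m+n₀})^{-5/3}`, so the shell clause shifted by `n₀`
(`Filter.tendsto_add_atTop_iff_nat`) gives the limit. Pure proof file (no definitions). [folklore]
-/

-- `Summit.<Summit>.<Problem>` is the tree's mandated summit-side namespace (CONVENTIONS §2); for this
-- single-conjunct summit the two coincide, so the duplicate is deliberate.
set_option linter.dupNamespace false

noncomputable section

namespace Summit.AnomalousDissipation.AnomalousDissipation.Theorems

open MeasureTheory Filter Topology Set Metric
open scoped InnerProductSpace ContDiff Laplacian
open Literature.Analysis.FunctionSpaces Literature.Analysis.FluidPDE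

/-- Physical space `ℝ³` (local notation, as in the registered skeleton). -/
local notation "E³" => EuclideanSpace ℝ (Fin 3)
/-- The flat three-torus (local notation, as in the registered skeleton). -/
local notation "𝕋³" => UnitAddTorus (Fin 3)

/-- Iterated discrete self-similarity: if `V (λ x) = λ^{-2/3} V x` off the origin, then
`V (λ^k x) = (λ^k)^{-2/3} V x` off the origin, for every `k : ℕ`. [folklore] -/
private theorem shellDefectScaling_dss_iterate {V : E³ → E³} {lam : ℝ} (hlam : 0 < lam)
    (hDSS : ∀ x : E³, x ≠ 0 → V (lam • x) = lam ^ (-(2 / 3 : ℝ)) • V x) (k : ℕ) (x : E³)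
    (hx : x ≠ 0) : V (lam ^ k • x) = (lam ^ k) ^ (-(2 / 3 : ℝ)) • V x := by
  induction k with
  | zero => simp
  | succ k ih =>
    have hkx : lam ^ k • x ≠ 0 := smul_ne_zero (pow_ne_zero k hlam.ne') hx
    rw [pow_succ', mul_smul, hDSS _ hkx, ih, smul_smul,
      Real.mul_rpow hlam.le (pow_nonneg hlam.le k)]

open scoped Pointwise in
/-- A dilation by `c > 0` maps the shell `r < |x| < R` onto the shell `c r < |y| < c R`.
[folklore] -/
private theorem shellDefectScaling_smul_shell {c : ℝ} (hc : 0 < c) (r R : ℝ) :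
    c • {x : E³ | r < ‖x‖ ∧ ‖x‖ < R} = {y : E³ | c * r < ‖y‖ ∧ ‖y‖ < c * R} := by
  ext y
  rw [Set.mem_smul_set_iff_inv_smul_mem₀ hc.ne', Set.mem_setOf_eq, Set.mem_setOf_eq, norm_smul,
    norm_inv, Real.norm_eq_abs, abs_of_pos hc, lt_inv_mul_iff₀ hc, inv_mul_lt_iff₀ hc]

/-- Exponent bookkeeping: `(c^{2/3})² · (c³)⁻¹ = c^{-5/3}` for `c > 0`. [folklore] -/
private theorem shellDefectScaling_rpow_aux {c : ℝ} (hc : 0 < c) :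
    (c ^ (2 / 3 : ℝ)) ^ 2 * (c ^ 3)⁻¹ = c ^ (-(5 / 3 : ℝ)) := by
  have h : (2 / 3 : ℝ) * ((2 : ℕ) : ℝ) + -((3 : ℕ) : ℝ) = -(5 / 3 : ℝ) := by norm_num
  rw [← Real.rpow_mul_natCast hc.le, ← Real.rpow_natCast c 3, ← Real.rpow_neg hc.le,
    ← Real.rpow_add hc, h]

open scoped Pointwise in
/-- Dilating the rescaled defect across a shell: for `c > 0`, `0 ≤ r` and a field `V` with
`V (c x) = c^{-2/3} V x` off the origin,
`∫_{r<|x|<R} |c^{2/3} Q (c x) − V x|² = c^{-5/3} ∫_{c r<|y|<c R} |Q y − V y|²`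
(both sides Bochner integrals; the substitution `y = c x` needs no integrability). [folklore] -/
private theorem shellDefectScaling_dilate (Q V : E³ → E³) {c : ℝ} (hc : 0 < c)
    (hV : ∀ x : E³, x ≠ 0 → V (c • x) = c ^ (-(2 / 3 : ℝ)) • V x) {r : ℝ} (hr : 0 ≤ r) (R : ℝ) :
    ∫ x in {x : E³ | r < ‖x‖ ∧ ‖x‖ < R}, ‖c ^ (2 / 3 : ℝ) • Q (c • x) - V x‖ ^ 2 =
      c ^ (-(5 / 3 : ℝ)) * ∫ y in {y : E³ | c * r < ‖y‖ ∧ ‖y‖ < c * R}, ‖Q y - V y‖ ^ 2 := by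
  have hmeas : MeasurableSet {x : E³ | r < ‖x‖ ∧ ‖x‖ < R} :=
    (measurableSet_lt measurable_const measurable_norm).inter
      (measurableSet_lt measurable_norm measurable_const)
  have hcr : 0 < c ^ (2 / 3 : ℝ) := Real.rpow_pos_of_pos hc _
  have hpt : EqOn (fun x : E³ => ‖c ^ (2 / 3 : ℝ) • Q (c • x) - V x‖ ^ 2)
      (fun x : E³ => (c ^ (2 / 3 : ℝ)) ^ 2 * ‖Q (c • x) - V (c • x)‖ ^ 2)
      {x : E³ | r < ‖x‖ ∧ ‖x‖ < R} := by
    intro x hx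
    have hx0 : x ≠ 0 := by
      rintro rfl
      exact (hr.trans_lt hx.1).ne' norm_zero
    have hVx : V x = c ^ (2 / 3 : ℝ) • V (c • x) := by
      rw [hV x hx0, smul_smul, Real.rpow_neg hc.le, mul_inv_cancel₀ hcr.ne', one_smul]
    simp only
    rw [hVx, ← smul_sub, norm_smul, Real.norm_eq_abs, abs_of_pos hcr, mul_pow]
  rw [setIntegral_congr_fun hmeas hpt, integral_const_mul,
    Measure.setIntegral_comp_smul_of_pos volume (fun y : E³ => ‖Q y - V y‖ ^ 2) _ hc,
    shellDefectScaling_smul_shell hc, smul_eq_mul, finrank_euclideanSpace_fin, ← mul_assoc,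
    shellDefectScaling_rpow_aux hc]

/-- **S1 `stub_shellDefectScaling`.** For a discretely self-similar far field
`V (λ x) = λ^{-2/3} V x` (`x ≠ 0`, `λ > 1`) and the rescalings `Q_k x = (λ^k)^{2/3} Q (λ^k x)`, the
change of variables `x ↦ λ^k x` gives, for every integer shell index `a` and every `k`,
`∫_{λ^a<|x|<λ^{a+1}} |Q_k − V|² = (λ^k)^{-5/3} ∫_{λ^{a+k}<|y|<λ^{a+k+1}} |Q − V|²`, so the shell clause
`(λ^n)^{-5/3} ∫_{λ^n<|x|<λ^{n+1}} |Q − V|² → 0` transports to every integer shell: the left side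
tends to `0` as `k → ∞` (index shift `n = a + k`, `Filter.tendsto_add_atTop_iff_nat`). [folklore] -/
theorem stub_shellDefectScaling :
    ∀ (Q V : E³ → E³) (lam : ℝ), 1 < lam →
      (∀ x : E³, x ≠ 0 → V (lam • x) = lam ^ (-(2 / 3 : ℝ)) • V x) →
      Tendsto (fun k : ℕ => (lam ^ k) ^ (-(5 / 3 : ℝ)) *
        ∫ x in {x : E³ | lam ^ k < ‖x‖ ∧ ‖x‖ < lam ^ (k + 1)}, ‖Q x - V x‖ ^ 2) atTop (𝓝 0) →
      ∀ a : ℤ, Tendsto (fun k : ℕ =>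
        ∫ x in {x : E³ | lam ^ a < ‖x‖ ∧ ‖x‖ < lam ^ (a + 1)},
          ‖(lam ^ k) ^ (2 / 3 : ℝ) • Q (lam ^ k • x) - V x‖ ^ 2) atTop (𝓝 0) := by
  intro Q V lam hlam hDSS hshell a
  have hlam0 : 0 < lam := one_pos.trans hlam
  -- (i)+(ii): the dilated closed form on the integer shell `a`, for every `k`
  have hF : ∀ k : ℕ,
      ∫ x in {x : E³ | lam ^ a < ‖x‖ ∧ ‖x‖ < lam ^ (a + 1)},
          ‖(lam ^ k) ^ (2 / 3 : ℝ) • Q (lam ^ k • x) - V x‖ ^ 2 =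
        (lam ^ k) ^ (-(5 / 3 : ℝ)) *
          ∫ y in {y : E³ | lam ^ (a + k) < ‖y‖ ∧ ‖y‖ < lam ^ (a + k + 1)}, ‖Q y - V y‖ ^ 2 := by
    intro k
    have h1 : lam ^ k * lam ^ a = lam ^ (a + k) := by
      rw [zpow_add₀ hlam0.ne', zpow_natCast, mul_comm]
    have h2 : lam ^ k * lam ^ (a + 1) = lam ^ (a + k + 1) := by
      rw [add_right_comm, zpow_add₀ hlam0.ne' (a + 1), zpow_natCast, mul_comm]
    rw [shellDefectScaling_dilate Q V (pow_pos hlam0 k) (shellDefectScaling_dss_iterate hlam0 hDSS k)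
      (zpow_pos hlam0 a).le, h1, h2]
  -- (iii): shift the index so that `a + k` is a natural number
  obtain ⟨k₀, hk₀⟩ : ∃ k₀ : ℕ, 0 ≤ a + k₀ := ⟨Int.toNat (-a), by omega⟩
  obtain ⟨n₀, hn₀⟩ : ∃ n₀ : ℕ, (n₀ : ℤ) = a + k₀ := ⟨Int.toNat (a + k₀), Int.toNat_of_nonneg hk₀⟩
  refine (Filter.tendsto_add_atTop_iff_nat k₀).1 ?_
  have hne : (lam ^ n₀) ^ (-(5 / 3 : ℝ)) ≠ 0 := (Real.rpow_pos_of_pos (pow_pos hlam0 n₀) _).ne'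
  have hlim := ((Filter.tendsto_add_atTop_iff_nat n₀).2 hshell).const_mul
    ((lam ^ k₀) ^ (-(5 / 3 : ℝ)) / (lam ^ n₀) ^ (-(5 / 3 : ℝ)))
  rw [mul_zero] at hlim
  refine hlim.congr fun m => ?_
  show _ = ∫ x in {x : E³ | lam ^ a < ‖x‖ ∧ ‖x‖ < lam ^ (a + 1)},
      ‖(lam ^ (m + k₀)) ^ (2 / 3 : ℝ) • Q (lam ^ (m + k₀) • x) - V x‖ ^ 2
  have hidx : a + ((m + k₀ : ℕ) : ℤ) = ((m + n₀ : ℕ) : ℤ) := by push_cast; omega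
  have hidx1 : a + ((m + k₀ : ℕ) : ℤ) + 1 = ((m + n₀ + 1 : ℕ) : ℤ) := by push_cast; omega
  rw [hF (m + k₀), hidx1, hidx, zpow_natCast, zpow_natCast]
  generalize (∫ y in {y : E³ | lam ^ (m + n₀) < ‖y‖ ∧ ‖y‖ < lam ^ (m + n₀ + 1)},
    ‖Q y - V y‖ ^ 2) = I
  rw [pow_add, pow_add, Real.mul_rpow (pow_nonneg hlam0.le _) (pow_nonneg hlam0.le _),
    Real.mul_rpow (pow_nonneg hlam0.le _) (pow_nonneg hlam0.le _)]
  calc (lam ^ k₀) ^ (-(5 / 3 : ℝ)) / (lam ^ n₀) ^ (-(5 / 3 : ℝ)) *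
        ((lam ^ m) ^ (-(5 / 3 : ℝ)) * (lam ^ n₀) ^ (-(5 / 3 : ℝ)) * I)
      = (lam ^ m) ^ (-(5 / 3 : ℝ)) * (lam ^ k₀) ^ (-(5 / 3 : ℝ)) * I *
          ((lam ^ n₀) ^ (-(5 / 3 : ℝ)) / (lam ^ n₀) ^ (-(5 / 3 : ℝ))) := by ring
    _ = (lam ^ m) ^ (-(5 / 3 : ℝ)) * (lam ^ k₀) ^ (-(5 / 3 : ℝ)) * I := by
      rw [div_self hne, mul_one]

end Summit.AnomalousDissipation.AnomalousDissipation.Theorems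

end
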